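import Summits.AtomisticToContinuum.HydrodynamicLimit.Theorems.ImplosionDichotomyDenseExcursionTiedStaticsRatio
import Summits.AtomisticToContinuum.HydrodynamicLimit.Theorems.PolynomialCompression.Negative.PdeForm

/-!
# Tied low-density statics to second order (stub `stub_tiedStatics`)

Crux `Summit.AtomisticToContinuum.HydrodynamicLimit.Theses.ImplosionDichotomy.DenseExcursion`
(stmt-AtomisticToContinuum-12586), line `kidder-knob-melnikov`, stub `stub_tiedStatics : TiedStatics`.

For continuous positive profiles `(a₀, u₀, θ₀)` with smooth normalised activity `β = a₀/∫a₀`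
(`P = profileOf a₀`), the witnesses are the tree's cluster-series density
`ρ₀^σ = rhoLim P σ = ∑_j γ_{j+1} R^{j+1} β^{j+1}` (`HardSphereEulerLLN`; `γ_{j+1} = clusterCoeff σ j =
σ^{3j} b_j / j!`, `R = ratioLimit P σ` the root of `R F(R) = 1`) and the explicit second-order coefficient
`h₂ = R₂ β + 2 R₁ b₁ β² + (b₂/2) β³`, `R₁ = -b₁ ∫β²`, `R₂ = 2R₁² - (b₂/2)∫β³` (`coeff₂`).

* since the first cluster constant is the Mayer bond integral `b₁ = -v₁ = -4π/3`
  (`TiedStaticsRatio.bE_one_eq`), the first-order coefficient `R₁ β + b₁ β² = -(4π/3) β (β - ∫β²)` is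
  LITERALLY the skeleton's `defect₁ β`.
* the scalar input — `b₁ = -4π/3` and the asymptotics `R = 1 + R₁σ³ + R₂σ⁶ + O(σ⁹)`,
  `R² = 1 + 2R₁σ³ + O(σ⁶)`, `R³ = 1 + O(σ³)` from `R F(R) = 1` — is the registered helper stub
  `TiedStaticsRatio.tiedStatics_ratioAsymptotics` (file `ImplosionDichotomyDenseExcursionTiedStaticsRatio`).
* `tail_bound`, `hasLiftDerivBounds_cubic`, `secondOrder_rate`: the `C^m` estimate
  `‖Dᵐ lift(ρ₀^σ - β - σ³ defect₁ β - σ⁶ h₂)‖ ≤ A_m σ⁹` — termwise differentiation of the tail `j ≥ 3`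
  of the lifted series (the sibling's `StaticsSmoothRate.norm_iteratedFDeriv_term_le`, Mathlib's
  `iteratedFDeriv_tsum_apply`) and the Leibniz calculus `Torus.HasLiftDerivBounds` for the cubic head,
  whose three scalar coefficients are `O(σ⁹)`.
* smoothness / positivity of `ρ₀^σ`, the probability-measure property and the identified law of large
  numbers through every flow family are the landed `StaticsSmoothRate.isSmooth_rhoLim_and_rate`,
  `SmallDensity.rhoLim_pos` and `PolynomialCompressionPDE.lln_rhoLim`.

References (orientation): Pulvirenti–Tsagkarogiannis, Comm. Math. Phys. 316 (2012) §3–5 (canonical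
cluster expansion); Spohn 1991, Part I §2.3 (local equilibrium and its law of large numbers).
-/

noncomputable section

open MeasureTheory Set Filter Topology

namespace Summit.AtomisticToContinuum.HydrodynamicLimit.Theorems.KidderKnobMelnikov

open Literature.MathematicalPhysics.KineticTheory (T3 V3 IsHardSphereEulerSolution hsDiameter localGibbsLaw
  TendstoHydroFieldsAt)
open Literature.Analysis.FunctionSpaces (Torus.proj Torus.IsSmooth Torus.lift)

/-! ## Stub 1 — tied low-density statics to second order (the data defect `H` of the card) -/

/-- First-order canonical excluded-volume defect of the LLN limit density of the local Gibbs law with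
normalised activity `b = a₀/∫a₀`: `h₁(b)(x) = −(4π/3) b(x) (b(x) − ∫ b²)` (second virial coefficient of
spheres of diameter `σ(N+1)^{-1/3}` at macroscopic density `(N+1)b`, then canonical re-normalisation
`∫ρ = 1`; note `∫ h₁(b) = 0` when `∫ b = 1`). This is the card's `H/σ³`. -/
def defect₁ (b : T3 → ℝ) (x : T3) : ℝ := -(4 * Real.pi / 3) * b x * (b x - ∫ y, b y ^ 2)

/-- Statement of `stub_tiedStatics`: for continuous positive profiles with SMOOTH normalised activity
`b = a₀/∫a₀` there are `σ₁ > 0`, densities `ρ₀^σ` (`0 < σ < σ₁`) and a smooth second-order coefficient `h₂`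
with `‖ρ₀^σ − b − σ³ h₁(b) − σ⁶ h₂‖_{C^m} ≤ A_m σ⁹` for every `m`, such that each `ρ₀^σ` is smooth and
positive, the local Gibbs laws are probability measures, and their `t = 0` empirical fields satisfy the law
of large numbers towards `(ρ₀^σ, u₀, θ₀)` for every family of hard-sphere flows. (Low-density cluster
expansion of the canonical one-point density, local in the `N → ∞` limit because the physical diameter
`σ(N+1)^{-1/3} → 0`; strengthens route support `LocalGibbsDensityLimit` (stmt-12591) and the sibling line's
`SmoothStatics` by exposing the first two Taylor coefficients in `σ³` — `h₁` explicitly, since it enters the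
Melnikov number `K₁`; `h₂` (needed for `K₂`) is pinned as the coefficient and is explicit in the proof.) -/
def TiedStatics : Prop :=
  ∀ (a₀ θ₀ : T3 → ℝ) (u₀ : T3 → V3), Continuous a₀ → Continuous θ₀ → Continuous u₀ →
    (∀ x, 0 < a₀ x) → (∀ x, 0 < θ₀ x) →
    Torus.IsSmooth (fun x => a₀ x / ∫ y, a₀ y) →
    ∃ σ₁ : ℝ, 0 < σ₁ ∧ ∃ (ρ₀ : ℝ → T3 → ℝ) (h₂ : T3 → ℝ), Torus.IsSmooth h₂ ∧
      (∀ m : ℕ, ∃ A : ℝ, ∀ σ : ℝ, 0 < σ → σ < σ₁ → ∀ y,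
        ‖iteratedFDeriv ℝ m (Torus.lift (fun x => ρ₀ σ x - a₀ x / (∫ y, a₀ y)
            - σ ^ 3 * defect₁ (fun x' => a₀ x' / ∫ y, a₀ y) x - σ ^ 6 * h₂ x)) y‖ ≤ A * σ ^ 9) ∧
      (∀ σ : ℝ, 0 < σ → σ < σ₁ →
        Torus.IsSmooth (ρ₀ σ) ∧ (∀ x, 0 < ρ₀ σ x) ∧
        ∀ Φ : (N : ℕ) → Literature.Analysis.FluidPDE.HardSphereFlow
            (Literature.Analysis.FluidPDE.Torus.geometry (Fin 3)) (hsDiameter σ N) (N + 1),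
          (∀ N, IsProbabilityMeasure (localGibbsLaw σ a₀ u₀ θ₀ N (Φ N))) ∧
          TendstoHydroFieldsAt (fun N => localGibbsLaw σ a₀ u₀ θ₀ N (Φ N)) Φ
            (fun _ => ρ₀ σ) (fun _ => u₀) (fun _ => θ₀) 0)

namespace TiedStaticsProof

open Literature.MathematicalPhysics.KineticTheory
open Literature.Analysis.FunctionSpaces
open Summit.AtomisticToContinuum.HydrodynamicLimit.Theorems.TiedStaticsRatio

/-! ## The `C^m` rate: cubic head and tail of the lifted cluster series -/

/-- The second-order coefficient `h₂ = R₂ β + 2 R₁ b₁ β² + (b₂/2) β³`. -/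
def coeff₂ (P : DensityProfile) (x : T3) : ℝ :=
  (2 * (-bE 1 * ∫ y, P.β y ^ 2) ^ 2 - bE 2 / 2 * ∫ y, P.β y ^ 3) * P.β x +
    2 * (-bE 1 * ∫ y, P.β y ^ 2) * bE 1 * P.β x ^ 2 + bE 2 / 2 * P.β x ^ 3

/-- **Leibniz bounds for a cubic polynomial in `β`**: if `‖Dⁱ lift β‖ ≤ M Lⁱ` (`i ≤ m`) then
`a β + b β² + c β³` obeys `HasLiftDerivBounds m · (|a| M + |b| M² + |c| M³) (3L)`. [folklore] -/
theorem hasLiftDerivBounds_cubic {P : DensityProfile} {m : ℕ} {L : ℝ} (hL0 : 0 ≤ L)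
    (hL : Torus.HasLiftDerivBounds m P.β P.M L) (a b c : ℝ) :
    Torus.HasLiftDerivBounds m (fun x => a * P.β x + b * P.β x ^ 2 + c * P.β x ^ 3)
      (|a| * P.M + |b| * P.M ^ 2 + |c| * P.M ^ 3) (3 * L) := by
  have hM := P.M_pos
  have h1 : Torus.HasLiftDerivBounds m (fun x => a * P.β x) (|a| * P.M) (3 * L) :=
    (hL.mono le_rfl hL0 (by linarith)).const_mul a
  have h2 : Torus.HasLiftDerivBounds m (fun x => b * P.β x ^ 2) (|b| * P.M ^ 2) (3 * L) := by
    have h := StaticsSmoothRate.hasLiftDerivBounds_pow hL hL0 2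
    exact (h.mono le_rfl (by positivity) (by push_cast; linarith)).const_mul b
  have h3 : Torus.HasLiftDerivBounds m (fun x => c * P.β x ^ 3) (|c| * P.M ^ 3) (3 * L) := by
    have h := StaticsSmoothRate.hasLiftDerivBounds_pow hL hL0 3
    exact (h.mono le_rfl (by positivity) (by push_cast; linarith)).const_mul c
  exact (h1.add h2).add h3

/-- **The tail `j ≥ 3` of the lifted cluster series is `C^m` with `‖Dᵐ‖ = O(θ³)`**:
`‖Dᵐ lift(∑_{j≥3} γ_{j+1} R^{j+1} β^{j+1})(y)‖ ≤ 2eM Lᵐ (∑_j (j+4)ᵐ 2^{-j}) θ³` (termwise bound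
`2eM Lᵐ (j+1)ᵐ θʲ`, `θ ≤ 1/2`, Mathlib `iteratedFDeriv_tsum_apply`). [folklore] -/
theorem tail_bound {P : DensityProfile} {σ : ℝ} (h : SmallDensity P σ) {m : ℕ} {L : ℝ} (hL1 : 1 ≤ L)
    (hL : Torus.HasLiftDerivBounds m P.β P.M L) :
    ContDiff ℝ m (Torus.lift fun x =>
        ∑' j, clusterCoeff σ (j + 3) * ratioLimit P σ ^ (j + 3 + 1) * P.β x ^ (j + 3 + 1)) ∧
      ∀ y, ‖iteratedFDeriv ℝ m (Torus.lift fun x =>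
          ∑' j, clusterCoeff σ (j + 3) * ratioLimit P σ ^ (j + 3 + 1) * P.β x ^ (j + 3 + 1)) y‖ ≤
        2 * Real.exp 1 * P.M * L ^ m * (∑' j : ℕ, ((j : ℝ) + 4) ^ m * (1 / 2 : ℝ) ^ j) *
          geomRatio P σ ^ 3 := by
  have hθ0 := h.geomRatio_nonneg
  have hθpos := StaticsSmoothRate.geomRatio_pos h
  have hθ1 := h.geomRatio_lt_one
  have hθ2 := StaticsSmoothRate.geomRatio_le_half h
  have hM := P.M_pos
  have hL0 : 0 ≤ L := zero_le_one.trans hL1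
  set T : ℕ → EuclideanSpace ℝ (Fin 3) → ℝ := fun j =>
    Torus.lift fun x => clusterCoeff σ j * ratioLimit P σ ^ (j + 1) * P.β x ^ (j + 1) with hT
  set v : ℕ → ℕ → ℝ := fun k j =>
    2 * Real.exp 1 * P.M * L ^ k * (((j : ℝ) + 1) ^ k * geomRatio P σ ^ j) with hv
  have hTs : ∀ j, ContDiff ℝ m (T j) := fun j =>
    ((StaticsSmoothRate.hasLiftDerivBounds_pow hL hL0 (j + 1)).const_mul
      (clusterCoeff σ j * ratioLimit P σ ^ (j + 1))).contDiff
  have hTv : ∀ (k j : ℕ) (y : EuclideanSpace ℝ (Fin 3)), k ≤ m →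
      ‖iteratedFDeriv ℝ k (T j) y‖ ≤ v k j :=
    fun k j y hk => StaticsSmoothRate.norm_iteratedFDeriv_term_le h hL1 (hL.of_le hk) j y
  have hvs : ∀ k, Summable (v k) := fun k => by
    have hs : Summable fun j : ℕ => ((j : ℝ) + 1) ^ k * geomRatio P σ ^ j := by
      simpa using StaticsSmoothRate.summable_add_pow_mul_geometric 1 k hθpos hθ1
    exact hs.mul_left _
  have hTs' : ∀ i, ContDiff ℝ m (fun y => T (i + 3) y) := fun i => hTs (i + 3)
  have hvs' : ∀ k : ℕ, (k : ℕ∞) ≤ m → Summable (fun i => v k (i + 3)) := fun k _ =>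
    (summable_nat_add_iff 3).2 (hvs k)
  have hTv' : ∀ (k i : ℕ) (y : EuclideanSpace ℝ (Fin 3)), (k : ℕ∞) ≤ m →
      ‖iteratedFDeriv ℝ k (fun y => T (i + 3) y) y‖ ≤ v k (i + 3) :=
    fun k i y hk => hTv k (i + 3) y (by exact_mod_cast hk)
  have hlift : (Torus.lift fun x => ∑' j, clusterCoeff σ (j + 3) * ratioLimit P σ ^ (j + 3 + 1) *
      P.β x ^ (j + 3 + 1)) = fun y => ∑' i, T (i + 3) y := rfl
  rw [hlift]
  refine ⟨contDiff_tsum (N := (m : ℕ∞)) hTs' hvs' hTv', fun y => ?_⟩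
  rw [iteratedFDeriv_tsum_apply (N := (m : ℕ∞)) hTs' hvs' hTv' le_rfl y]
  have hS : Summable fun j : ℕ => ((j : ℝ) + 4) ^ m * (1 / 2 : ℝ) ^ j := by
    simpa using StaticsSmoothRate.summable_add_pow_mul_geometric 4 m
      (by norm_num : (0 : ℝ) < 1 / 2) (by norm_num)
  have hmain : ‖∑' i, iteratedFDeriv ℝ m (fun y => T (i + 3) y) y‖ ≤
      (2 * Real.exp 1 * P.M * L ^ m * geomRatio P σ ^ 3) *
        ∑' j : ℕ, ((j : ℝ) + 4) ^ m * (1 / 2 : ℝ) ^ j := by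
    refine tsum_of_norm_bounded (hS.hasSum.mul_left _) fun i => ?_
    refine (hTv' m i y le_rfl).trans ?_
    show 2 * Real.exp 1 * P.M * L ^ m * ((((i + 3 : ℕ) : ℝ) + 1) ^ m * geomRatio P σ ^ (i + 3)) ≤ _
    have hi : ((i + 3 : ℕ) : ℝ) + 1 = (i : ℝ) + 4 := by push_cast; ring
    have hpow : geomRatio P σ ^ (i + 3) ≤ geomRatio P σ ^ 3 * (1 / 2 : ℝ) ^ i := by
      rw [pow_add, mul_comm]
      exact mul_le_mul_of_nonneg_left (pow_le_pow_left₀ hθ0 hθ2 i) (pow_nonneg hθ0 3)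
    rw [hi]
    calc 2 * Real.exp 1 * P.M * L ^ m * (((i : ℝ) + 4) ^ m * geomRatio P σ ^ (i + 3))
        ≤ 2 * Real.exp 1 * P.M * L ^ m * (((i : ℝ) + 4) ^ m * (geomRatio P σ ^ 3 * (1 / 2 : ℝ) ^ i)) := by
          gcongr
      _ = _ := by ring
  calc _ ≤ _ := hmain
    _ = _ := by ring

/-- **The cluster series split after three terms**:
`ρ₀ = R β + γ₂ R² β² + γ₃ R³ β³ + ∑_{j ≥ 3} γ_{j+1} R^{j+1} β^{j+1}` (`γ₁ = 1`). [folklore] -/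
theorem rhoLim_eq_head_add_tail {P : DensityProfile} {σ : ℝ} (h : SmallDensity P σ) (x : T3) :
    rhoLim P σ x = ratioLimit P σ * P.β x + clusterCoeff σ 1 * ratioLimit P σ ^ 2 * P.β x ^ 2 +
      clusterCoeff σ 2 * ratioLimit P σ ^ 3 * P.β x ^ 3 +
      ∑' j, clusterCoeff σ (j + 3) * ratioLimit P σ ^ (j + 3 + 1) * P.β x ^ (j + 3 + 1) := by
  have hsplit := (h.summable_rhoLim x).sum_add_tsum_nat_add 3
  rw [rhoLim, ← hsplit, Finset.sum_range_succ, Finset.sum_range_succ, Finset.sum_range_one,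
    StaticsSmoothRate.clusterCoeff_zero h]
  ring

/-- **The `C^m` statics rate to second order.** For a profile with smooth `β` and every `m` there is
`A = A_m(β)` with `‖Dᵐ lift(rhoLim P σ - β + (4π/3)σ³ β(β - ∫β²) - σ⁶ h₂)(y)‖ ≤ A σ⁹` whenever
`SmallDensity P σ`. [folklore] -/
theorem secondOrder_rate {P : DensityProfile} (hβ : Torus.IsSmooth P.β) (m : ℕ) :
    ∃ A : ℝ, ∀ σ : ℝ, SmallDensity P σ → ∀ y : EuclideanSpace ℝ (Fin 3),
      ‖iteratedFDeriv ℝ m (Torus.lift fun x => rhoLim P σ x - P.β x -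
          σ ^ 3 * (-(4 * Real.pi / 3) * P.β x * (P.β x - ∫ y, P.β y ^ 2)) - σ ^ 6 * coeff₂ P x) y‖ ≤
        A * σ ^ 9 := by
  have hM := P.M_pos
  set K := 2 * Real.exp 1 * P.M * v₁ with hK
  have hK0 : 0 < K := K_pos P
  obtain ⟨L, hL1, hL⟩ := StaticsSmoothRate.exists_hasLiftDerivBounds hβ hM
    (fun x => by rw [abs_of_pos (P.pos x)]; exact P.le_M x) m
  have hL0 : 0 ≤ L := zero_le_one.trans hL1
  obtain ⟨C, hC⟩ := tiedStatics_ratioAsymptotics.2 P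
  set S := ∑' j : ℕ, ((j : ℝ) + 4) ^ m * (1 / 2 : ℝ) ^ j with hS
  refine ⟨(C * P.M + |bE 1| * C * P.M ^ 2 + |bE 2| / 2 * C * P.M ^ 3) * (3 * L) ^ m +
      2 * Real.exp 1 * P.M * L ^ m * S * K ^ 3, fun σ h y => ?_⟩
  have hσ0 := h.σ_pos
  obtain ⟨hE₃, hE₂, hE₁⟩ := hC σ h
  -- the three scalar coefficients of the head, all `O(σ⁹)`
  set a := ratioLimit P σ - 1 - (-bE 1 * ∫ y, P.β y ^ 2) * σ ^ 3 -
    (2 * (-bE 1 * ∫ y, P.β y ^ 2) ^ 2 - bE 2 / 2 * ∫ y, P.β y ^ 3) * σ ^ 6 with ha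
  set b := σ ^ 3 * bE 1 * (ratioLimit P σ ^ 2 - 1 - 2 * (-bE 1 * ∫ y, P.β y ^ 2) * σ ^ 3) with hb
  set c := σ ^ 6 * (bE 2 / 2) * (ratioLimit P σ ^ 3 - 1) with hc
  have ha' : |a| ≤ C * σ ^ 9 := hE₁
  have hb' : |b| ≤ σ ^ 3 * |bE 1| * (C * σ ^ 6) := by
    rw [hb, abs_mul, abs_mul, abs_of_pos (pow_pos hσ0 3)]
    gcongr
  have hc' : |c| ≤ σ ^ 6 * (|bE 2| / 2) * (C * σ ^ 3) := by
    rw [hc, abs_mul, abs_mul, abs_of_pos (pow_pos hσ0 6), abs_div, abs_two]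
    gcongr
  -- the decomposition `head + tail`
  have hfun : (fun x => rhoLim P σ x - P.β x -
      σ ^ 3 * (-(4 * Real.pi / 3) * P.β x * (P.β x - ∫ y, P.β y ^ 2)) - σ ^ 6 * coeff₂ P x) =
      fun x => (a * P.β x + b * P.β x ^ 2 + c * P.β x ^ 3) +
        ∑' j, clusterCoeff σ (j + 3) * ratioLimit P σ ^ (j + 3 + 1) * P.β x ^ (j + 3 + 1) := by
    funext x
    rw [rhoLim_eq_head_add_tail h x, ha, hb, hc, coeff₂, clusterCoeff_one, clusterCoeff_two, bE_one_eq]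
    ring
  rw [hfun]
  have hH := hasLiftDerivBounds_cubic hL0 hL a b c
  obtain ⟨hTc, hTb⟩ := tail_bound h hL1 hL
  have hlift : (Torus.lift fun x => (a * P.β x + b * P.β x ^ 2 + c * P.β x ^ 3) +
      ∑' j, clusterCoeff σ (j + 3) * ratioLimit P σ ^ (j + 3 + 1) * P.β x ^ (j + 3 + 1)) =
      Torus.lift (fun x => a * P.β x + b * P.β x ^ 2 + c * P.β x ^ 3) +
        Torus.lift (fun x => ∑' j, clusterCoeff σ (j + 3) * ratioLimit P σ ^ (j + 3 + 1) *
          P.β x ^ (j + 3 + 1)) := rfl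
  rw [hlift, iteratedFDeriv_add_apply hH.contDiff.contDiffAt hTc.contDiffAt]
  refine (norm_add_le _ _).trans ?_
  have h1 := hH.bound le_rfl y
  have h2 := hTb y
  rw [geomRatio_eq, ← hK] at h2
  have h3L : 0 ≤ (3 * L) ^ m := by positivity
  calc _ ≤ (|a| * P.M + |b| * P.M ^ 2 + |c| * P.M ^ 3) * (3 * L) ^ m +
        2 * Real.exp 1 * P.M * L ^ m * S * (K * σ ^ 3) ^ 3 := add_le_add h1 h2
    _ ≤ (C * σ ^ 9 * P.M + (σ ^ 3 * |bE 1| * (C * σ ^ 6)) * P.M ^ 2 +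
          (σ ^ 6 * (|bE 2| / 2) * (C * σ ^ 3)) * P.M ^ 3) * (3 * L) ^ m +
        2 * Real.exp 1 * P.M * L ^ m * S * (K * σ ^ 3) ^ 3 := by
        gcongr
    _ = _ := by ring

end TiedStaticsProof

/-! ## The registered stub -/

open TiedStaticsProof TiedStaticsRatio Literature.MathematicalPhysics.KineticTheory Literature.Analysis.FunctionSpaces in
/-- **Tied smooth low-density statics to second order** (stub `stub_tiedStatics` of the line
`kidder-knob-melnikov`, crux `ImplosionDichotomy.DenseExcursion`). For continuous positive profiles with
smooth normalised activity `β = a₀/∫a₀`: below the threshold `σ₁` of `PolynomialCompressionPDE.lln_rhoLim`,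
the cluster-series densities `ρ₀^σ = rhoLim (profileOf a₀) σ` are smooth and positive, satisfy
`‖ρ₀^σ - β - σ³ defect₁ β - σ⁶ h₂‖_{C^m} ≤ A_m σ⁹` with the explicit smooth `h₂ = coeff₂ (profileOf a₀)`,
and the local Gibbs laws are probability measures whose `t = 0` empirical fields converge in probability
to `(ρ₀^σ, u₀, θ₀)` through every hard-sphere flow family. [folklore] -/
theorem stub_tiedStatics : TiedStatics := by
  intro a₀ θ₀ u₀ ha hθ hu ha0 hθ0 hβ
  set P := profileOf a₀ ha ha0 with hP
  have hβ' : Torus.IsSmooth P.β := hβ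
  obtain ⟨σ₁, hσ₁, -, H⟩ := PolynomialCompressionPDE.lln_rhoLim (u₀ := u₀) ha hθ hu ha0 hθ0
  have hLex : ∀ k, ∃ L : ℝ, 1 ≤ L ∧ Torus.HasLiftDerivBounds k P.β P.M L := fun k =>
    StaticsSmoothRate.exists_hasLiftDerivBounds hβ' P.M_pos
      (fun x => by rw [abs_of_pos (P.pos x)]; exact P.le_M x) k
  choose L hL1 hL using hLex
  refine ⟨σ₁, hσ₁, fun σ => rhoLim P σ, coeff₂ P, ?_, fun m => ?_, fun σ hσ hσ1 => ?_⟩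
  · exact (hasLiftDerivBounds_cubic (zero_le_one.trans (hL1 0)) (hL 0)
      (2 * (-bE 1 * ∫ y, P.β y ^ 2) ^ 2 - bE 2 / 2 * ∫ y, P.β y ^ 3)
      (2 * (-bE 1 * ∫ y, P.β y ^ 2) * bE 1) (bE 2 / 2)).isSmooth
  · obtain ⟨A, hA⟩ := secondOrder_rate hβ' m
    refine ⟨A, fun σ hσ hσ1 y => ?_⟩
    obtain ⟨h, -, -⟩ := H σ hσ hσ1
    exact hA σ h y
  · obtain ⟨h, hpos, hlln⟩ := H σ hσ hσ1
    exact ⟨(StaticsSmoothRate.isSmooth_rhoLim_and_rate h hβ' hL1 hL).1, fun x => h.rhoLim_pos (hpos x),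
      fun Φ => hlln Φ⟩

end Summit.AtomisticToContinuum.HydrodynamicLimit.Theorems.KidderKnobMelnikov

end
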